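import Summits.HubbardSuperconductivity.HubbardSuperconductivity.Theorems.LevyLogBootstrapLevyTransportInfraredBound
import Literature.MathematicalPhysics.QuantumLattice.GroundStateReflectionPositivity
import Literature.MathematicalPhysics.QuantumLattice.XXZSublatticeHalfTurn

/-!
# Route `LevyLogBootstrap`, crux `Block2InfDivXXZ` (stmt-HubbardSuperconductivity-15048) — support:
# reflection positivity of the ground-state transverse kernel of the easy-plane XXZ torus

The crux `Block2InfDivXXZ` (⇔ `levyCoeff_nonneg`, `…Theorems.LevyLogBootstrapBlock2InfDivXXZLevyEquivalence`)
is a positivity statement about the LOGARITHM of the `2 × 2`-block transverse kernel of the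
`S³_tot = 0` ground state `ψ` of `H_M(Δ) = xxzHamiltonian 1 (torusGraph 2 M) (-1) Δ`, `Δ ∈ [-1, 0]`.
Every quantitative attack recorded on the item (crux ideas `af-levy-flow`,
`spinwave-levy-reference-sandwich`; the small-`M` feasibility analysis) uses, besides positive
definiteness of the kernel, its REFLECTION POSITIVITY across the bond planes of the torus
("Hankel positivity per transverse momentum"). This file proves that input, for every `Δ ≤ 0`:

* `transverseGram_posSemidef_of_kroneckerForm` — abstract transfer: if a unitary `W` fixing every
  `S¹_x` conjugates a Hermitian `H` with non-degenerate ground state into a Kennedy–Lieb–Shastry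
  Kronecker form `A ⊗ 1 + 1 ⊗ A - Σᵢ Mᵢ ⊗ Mᵢ` (`Aᵀ = A`, `Mᵢ` real) along the planes `(j, a)`, then
  for every unit ground vector `ψ` of `H` and sites `x₁, …, x_k` of the left half the Gram matrix
  `[⟨ψ, S¹_{x_l} S¹_{θ x_i} ψ⟩]_{il}` is positive semidefinite (ground-state reflection positivity,
  `Matrix.exists_posSemidef_groundState` + `Matrix.posSemidef_kronecker_gram`, transported back
  through `W` and the tensor-square identification `torusSplit`);
* `sectorGS_transverseGram_posSemidef` — the instance for `H_M(Δ)`, `Δ ≤ 0`, even `M ≥ 4`, every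
  unit ground vector (KLS sublattice rotation `exists_sublatticeHalfTurnX`; Kronecker forms
  `xyRealFieldHamiltonian_eq_submatrix` (`Δ = 0`) / `xyzRealFieldHamiltonian_eq_submatrix`
  (`Δ < 0`); uniqueness `xxzTorus_groundSpace_eq_span`);
* `sectorGS_transverseGram_posSemidef_of_sectorGS` — the same for the half-filled SECTOR ground
  state in the form the route's statements quantify over (`H ψ = E_sector ψ`), and
  `sectorGS_transverse_reflect_nonneg` / `sectorGS_transverse_reflection_cauchySchwarz` — the one-
  and two-site consequences `0 ≤ ⟨ψ, S¹_x S¹_{θx} ψ⟩`,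
  `|⟨ψ, S¹_x S¹_{θy} ψ⟩|² ≤ ⟨ψ, S¹_x S¹_{θx} ψ⟩⟨ψ, S¹_y S¹_{θy} ψ⟩`;
* `sectorGS_raiseLowerGram_posSemidef` — the same in the crux's vocabulary: `[⟨ψ, S⁺_{x_l} S⁻_{θ x_i} ψ⟩]_{il}`
  (`= 2·[⟨ψ, S¹S¹ψ⟩]`, by the frame dictionary of `…LevyTransportInfraredBound`) is positive
  semidefinite, so the route's kernel `K_ψ(x, y) = Re ⟨ψ, S⁺_x S⁻_y ψ⟩` is reflection positive.

Kennedy–Lieb–Shastry, J. Stat. Phys. 53 (1988), eqs. (15)–(25); Dyson–Lieb–Simon, J. Stat. Phys. 18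
(1978) §4; Kubo–Kishi, PRL 61 (1988) 2585. No definition is introduced.
-/

-- the mandated namespace `Summit.<Summit>.<Problem>.Theorems` repeats `HubbardSuperconductivity`
set_option linter.dupNamespace false

noncomputable section

namespace Summit.HubbardSuperconductivity.HubbardSuperconductivity.Theorems.LevyLogBootstrap

open Matrix Finset Literature.MathematicalPhysics.QuantumLattice Literature.Probability.LatticeModels
open scoped ComplexOrder Kronecker

variable {d : ℕ}

/-! ### Conjugating vector states by a unitary -/

/-- `⟨Wᴴw, O Wᴴw⟩ = ⟨w, (W O Wᴴ) w⟩`. [folklore] -/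
theorem star_conjTranspose_mulVec_dotProduct {m : Type*} [Fintype m] (W O : Matrix m m ℂ)
    (w : m → ℂ) :
    star (Wᴴ *ᵥ w) ⬝ᵥ (O *ᵥ (Wᴴ *ᵥ w)) = star w ⬝ᵥ ((W * O * Wᴴ) *ᵥ w) := by
  rw [star_mulVec, conjTranspose_conjTranspose, ← dotProduct_mulVec, mulVec_mulVec, mulVec_mulVec,
    Matrix.mul_assoc]

/-- A unitary preserves the norm: `⟨Wᴴw, Wᴴw⟩ = ⟨w, w⟩` when `W Wᴴ = 1`. [folklore] -/
theorem star_conjTranspose_mulVec_dotProduct_self {m : Type*} [Fintype m] [DecidableEq m]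
    {W : Matrix m m ℂ} (hWW : W * Wᴴ = 1) (w : m → ℂ) :
    star (Wᴴ *ᵥ w) ⬝ᵥ (Wᴴ *ᵥ w) = star w ⬝ᵥ w := by
  rw [star_mulVec, conjTranspose_conjTranspose, ← dotProduct_mulVec, mulVec_mulVec, hWW, one_mulVec]

/-! ### The abstract transfer -/

/-- **Reflection positivity of ground-state transverse two-point functions, abstract form.**
Let `H` be a Hermitian operator on the spin configurations of the even torus with a NON-DEGENERATE
ground state, and let `W` be a unitary that fixes every `S¹_x` and conjugates `H` into the
Kennedy–Lieb–Shastry Kronecker form along the planes `(j, a)`: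
`W H Wᴴ = (A ⊗ 1 + 1 ⊗ A - Σᵢ Mᵢ ⊗ Mᵢ) ∘ (torusSplit × torusSplit)` with `Aᵀ = A` and real `Mᵢ`.
Then for every unit ground vector `ψ` of `H` and every family `x₁, …, x_k` of sites of the left
half, the Gram matrix `[⟨ψ, S¹_{x_l} S¹_{θ x_i} ψ⟩]_{il}` is positive semidefinite.
(The Kronecker form has a positive semidefinite ground state `vec c`
(`Matrix.exists_posSemidef_groundState`), which is reflection positive
(`Matrix.posSemidef_kronecker_gram`); `Wᴴ(vec c ∘ torusSplit)` is a unit ground vector of `H`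
with the same expectations as `ψ` (uniqueness), and `S¹_{x_l} S¹_{θ x_i} = ι_L(S¹) ι_R(S¹)` is
`W`-invariant.) Kennedy–Lieb–Shastry (1988) eqs. (20)–(25); Dyson–Lieb–Simon (1978) Thm. 4.2.
[folklore] -/
theorem transverseGram_posSemidef_of_kroneckerForm (L : ℕ) [NeZero L] (j : Fin d) (a : ZMod L)
    (hL : Even L) (n : ℕ) {H W : Op (TorusSite d L) (n + 1)} (hH : H.IsHermitian)
    (hHU : H.HasUniqueGroundState) (hWW : W * Wᴴ = 1) (hWW' : Wᴴ * W = 1)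
    (hW0 : ∀ x, W * siteSpin n x 0 * Wᴴ = siteSpin n x 0)
    {ι : Type*} [Fintype ι] (A : Op (torusLeftHalf L j a) (n + 1))
    (M : ι → Op (torusLeftHalf L j a) (n + 1)) (hA : Aᵀ = A) (hMt : ∀ i, (M i)ᵀ = (M i)ᴴ)
    (hK : W * H * Wᴴ = (A ⊗ₖ (1 : Op (torusLeftHalf L j a) (n + 1)) +
        (1 : Op (torusLeftHalf L j a) (n + 1)) ⊗ₖ A - ∑ i, M i ⊗ₖ M i).submatrix
          (torusSplit (q := n + 1) L j a hL) (torusSplit (q := n + 1) L j a hL))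
    {ψ : TensorIndex (TorusSite d L) (n + 1) → ℂ} (hψ : ψ ∈ H.groundSpace)
    (hψ1 : star ψ ⬝ᵥ ψ = 1) {κ : Type*} [Fintype κ] (x : κ → TorusSite d L)
    (hx : ∀ i, x i ∈ torusLeftHalf L j a) :
    (Matrix.of fun i l : κ => star ψ ⬝ᵥ
      ((siteSpin n (x l) 0 * siteSpin n (Torus.reflectBetweenSites j a (x i)) 0) *ᵥ ψ)).PosSemidef := by
  set e := torusSplit (q := n + 1) L j a hL with he
  set K : Matrix ((torusLeftHalf L j a → Fin (n + 1)) × (torusLeftHalf L j a → Fin (n + 1)))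
      ((torusLeftHalf L j a → Fin (n + 1)) × (torusLeftHalf L j a → Fin (n + 1))) ℂ :=
    A ⊗ₖ (1 : Op (torusLeftHalf L j a) (n + 1)) + (1 : Op (torusLeftHalf L j a) (n + 1)) ⊗ₖ A -
      ∑ i, M i ⊗ₖ M i with hKdef
  haveI : Nonempty ((torusLeftHalf L j a → Fin (n + 1)) × (torusLeftHalf L j a → Fin (n + 1))) :=
    ⟨(fun _ => 0, fun _ => 0)⟩
  haveI : Nonempty (TensorIndex (TorusSite d L) (n + 1)) := ⟨fun _ => 0⟩
  have hU : W ∈ Matrix.unitaryGroup (TensorIndex (TorusSite d L) (n + 1)) ℂ :=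
    Matrix.mem_unitaryGroup_iff.2 hWW
  -- `K` is Hermitian and has the ground energy of `H`
  have hKe : K = (W * H * Wᴴ).submatrix e.symm e.symm := by
    rw [hK, submatrix_submatrix, Equiv.self_comp_symm, submatrix_id_id]
  have hKh : K.IsHermitian := by
    rw [hKe]; exact (isHermitian_mul_mul_conjTranspose W hH).submatrix _
  have hKE : K.groundEnergy = H.groundEnergy := by
    rw [← Matrix.groundEnergy_submatrix_equiv hKh e, ← hK, Matrix.groundEnergy_unitary_conj hU]
  -- the positive semidefinite ground state of `K`, pulled back to a ground vector `u` of `H`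
  obtain ⟨c, hc, hc1, hcmem⟩ := Matrix.exists_posSemidef_groundState A M hA hMt hKh
  set vc : (torusLeftHalf L j a → Fin (n + 1)) × (torusLeftHalf L j a → Fin (n + 1)) → ℂ :=
    fun p => c p.1 p.2 with hvc
  set w : TensorIndex (TorusSite d L) (n + 1) → ℂ := vc ∘ e with hw
  set u : TensorIndex (TorusSite d L) (n + 1) → ℂ := Wᴴ *ᵥ w with hu
  have hHWK : H = Wᴴ * (K.submatrix e e) * W := by
    rw [← hK]
    simp only [Matrix.mul_assoc]
    rw [hWW', Matrix.mul_one, ← Matrix.mul_assoc, hWW', Matrix.one_mul]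
  have hKvc : K *ᵥ vc = (K.groundEnergy : ℂ) • vc := (mem_groundSpace_iff K vc).1 hcmem
  have hHu : H *ᵥ u = (H.groundEnergy : ℂ) • u := by
    have h1 : H *ᵥ u = Wᴴ *ᵥ ((K.submatrix e e) *ᵥ (W *ᵥ (Wᴴ *ᵥ w))) := by
      conv_lhs => rw [hHWK]
      rw [hu, ← mulVec_mulVec, ← mulVec_mulVec]
    rw [h1, mulVec_mulVec w, hWW, one_mulVec, hw, submatrix_mulVec_equiv,
      show (vc ∘ ⇑e) ∘ ⇑e.symm = vc by rw [Function.comp_assoc, Equiv.self_comp_symm, Function.comp_id],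
      hKvc, hKE, hu, hw,
      show (((H.groundEnergy : ℂ)) • vc) ∘ ⇑e = (H.groundEnergy : ℂ) • (vc ∘ ⇑e) from rfl, mulVec_smul]
  have humem : u ∈ H.groundSpace := (mem_groundSpace_iff H u).2 hHu
  have hu1 : star u ⬝ᵥ u = 1 := by
    rw [hu, star_conjTranspose_mulVec_dotProduct_self hWW, hw, Matrix.star_comp_dotProduct_comp, hc1]
  -- the observables `S¹_{x_l} S¹_{θ x_i}` are `X_l ⊗ X_i`, `W`-invariant
  set X : κ → Op (torusLeftHalf L j a) (n + 1) := fun i => siteSpin n (torusToLeft L j a hL (x i)) 0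
    with hX
  have hXr : ∀ i, (X i).map star = X i := fun i => by
    have h : ((X i).map star)ᵀ = (X i)ᵀ := by
      rw [Matrix.transpose_map_star, hX, siteSpin_zero_transpose_eq]
    exact transpose_injective h
  have hO : ∀ i l : κ, siteSpin n (x l) 0 * siteSpin n (Torus.reflectBetweenSites j a (x i)) 0 =
      (X l ⊗ₖ X i).submatrix e e := by
    intro i l
    have hxi : Torus.reflectBetweenSites j a (x i) ∉ torusLeftHalf L j a := fun h' =>
      (reflectBetweenSites_mem_torusLeftHalf_iff L j a hL (x i)).1 h' (hx i)
    rw [siteSpin_eq_torusLeftEmbed (hL := hL) n (hx l) 0, siteSpin_eq_torusRightEmbed (hL := hL) n hxi 0,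
      torusToLeft_reflectBetweenSites, torusLeftEmbed_mul_torusRightEmbed]
  have hWO : ∀ i l : κ, W * (siteSpin n (x l) 0 * siteSpin n (Torus.reflectBetweenSites j a (x i)) 0) * Wᴴ =
      siteSpin n (x l) 0 * siteSpin n (Torus.reflectBetweenSites j a (x i)) 0 := by
    intro i l
    rw [show W * (siteSpin n (x l) 0 * siteSpin n (Torus.reflectBetweenSites j a (x i)) 0) * Wᴴ =
        (W * siteSpin n (x l) 0 * Wᴴ) * (W * siteSpin n (Torus.reflectBetweenSites j a (x i)) 0 * Wᴴ) by
      simp only [Matrix.mul_assoc]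
      rw [← Matrix.mul_assoc Wᴴ W, hWW', Matrix.one_mul], hW0, hW0]
  -- the Gram matrix of `ψ` is the Gram matrix of the reflection-positive state `vec c`
  have hG : (Matrix.of fun i l : κ => star ψ ⬝ᵥ
      ((siteSpin n (x l) 0 * siteSpin n (Torus.reflectBetweenSites j a (x i)) 0) *ᵥ ψ)) =
      Matrix.of fun i l : κ => star vc ⬝ᵥ ((X l ⊗ₖ (X i).map star) *ᵥ vc) := by
    ext i l
    rw [of_apply, of_apply, hXr,
      Matrix.dotProduct_mulVec_eq_of_hasUniqueGroundState hHU humem hψ hu1 hψ1, hu,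
      star_conjTranspose_mulVec_dotProduct, hWO, hO, hw, submatrix_mulVec_equiv,
      show (vc ∘ ⇑e) ∘ ⇑e.symm = vc by rw [Function.comp_assoc, Equiv.self_comp_symm, Function.comp_id],
      Matrix.star_comp_dotProduct_comp]
  rw [hG]
  exact Matrix.posSemidef_kronecker_gram hc X

/-! ### The easy-plane XXZ torus -/

/-- The easy-plane spin-½ XXZ torus has a non-degenerate ground state (`Δ ≤ 0`, even `M ≥ 4`).
[folklore] -/
theorem xxzTorus_hasUniqueGroundState (M : ℕ) [NeZero M] (hM : Even M) (h4 : 4 ≤ M) {Δ : ℝ}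
    (hΔ : Δ ≤ 0) : (xxzHamiltonian 1 (torusGraph 2 M) (-1) Δ).HasUniqueGroundState := by
  obtain ⟨φ, hφ0, -, hspan, -⟩ := xxzTorus_groundSpace_eq_span M hM h4 hΔ
  change Module.finrank ℂ (xxzHamiltonian 1 (torusGraph 2 M) (-1) Δ).groundSpace = 1
  rw [hspan]
  exact finrank_span_singleton hφ0

/-- **Reflection positivity of the ground-state transverse kernel of the easy-plane XXZ torus.**
For `H_M(Δ) = xxzHamiltonian 1 (torusGraph 2 M) (-1) Δ` with `Δ ≤ 0` on the even torus of side
`M ≥ 4`, every unit ground vector `ψ`, every pair of reflection planes `(j, a)` and every family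
`x₁, …, x_k` of sites of the left half, the Gram matrix `[⟨ψ, S¹_{x_l} S¹_{θ x_i} ψ⟩]_{il}` is
positive semidefinite. Kennedy–Lieb–Shastry, J. Stat. Phys. 53 (1988), eqs. (15)–(25);
Dyson–Lieb–Simon (1978) Thm. 4.2; Kubo–Kishi, PRL 61 (1988) 2585. [folklore] -/
theorem sectorGS_transverseGram_posSemidef (M : ℕ) [NeZero M] (hM : Even M) (h4 : 4 ≤ M)
    {Δ : ℝ} (hΔ : Δ ≤ 0) {ψ : TensorIndex (TorusSite 2 M) 2 → ℂ}
    (hψ : ψ ∈ (xxzHamiltonian 1 (torusGraph 2 M) (-1) Δ).groundSpace) (hψ1 : star ψ ⬝ᵥ ψ = 1)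
    (j : Fin 2) (a : ZMod M) {κ : Type*} [Fintype κ] (x : κ → TorusSite 2 M)
    (hx : ∀ i, x i ∈ torusLeftHalf M j a) :
    (Matrix.of fun i l : κ => star ψ ⬝ᵥ
      ((siteSpin 1 (x l) 0 * siteSpin 1 (Torus.reflectBetweenSites j a (x i)) 0) *ᵥ ψ)).PosSemidef := by
  have hHU := xxzTorus_hasUniqueGroundState M hM h4 hΔ
  have hH : (xxzHamiltonian 1 (torusGraph 2 M) (-1) Δ).IsHermitian := xxzHamiltonian_isHermitian 1 _ (-1) Δ
  obtain ⟨k, rfl⟩ : ∃ k, M = 2 * k := ⟨M / 2, by obtain ⟨k, hk⟩ := hM; omega⟩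
  obtain ⟨W, sgn, hWW, hWW', hW0, -, -, -, -, -, hXY, hXXZ⟩ := exists_sublatticeHalfTurnX (d := 2) k 1
  rcases lt_or_eq_of_le hΔ with hΔ' | rfl
  · -- `Δ < 0`: Björnberg–Ueltschi's real form
    set s : ℝ := Real.sqrt (-Δ)⁻¹ with hs
    set c : ℝ := Real.sqrt (-Δ) with hc
    have hc2 : ((c : ℝ) : ℂ) * (c : ℂ) = ((-Δ : ℝ) : ℂ) := by
      rw [← Complex.ofReal_mul, hc, Real.mul_self_sqrt (by linarith)]
    set A₀ := xyzLeftHamiltonian (2 * k) j a hM 1 (s ^ 2) (-(s ^ 2)) 0 with hA₀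
    set M₀ := xyzCrossOp (2 * k) j a hM 1 s s 0 with hM₀
    refine transverseGram_posSemidef_of_kroneckerForm (2 * k) j a hM 1 hH hHU hWW hWW' hW0
      (((-Δ : ℝ) : ℂ) • A₀) (fun i => ((c : ℝ) : ℂ) • M₀ i) ?_ ?_ ?_ hψ hψ1 x hx
    · rw [transpose_smul, hA₀, xyzLeftHamiltonian_transpose (2 * k) j a 1 _ _ hM 0]
    · intro i
      rw [transpose_smul, conjTranspose_smul, Complex.star_def, Complex.conj_ofReal, hM₀,
        xyzCrossOp_transpose_eq (2 * k) j a 1 hM s s 0 i]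
    · have h := xyzRealFieldHamiltonian_eq_submatrix (2 * k) j a hM 1 s s 0
      have h0 : (fun y => (0 : TorusSite 2 (2 * k) → ℝ) (Torus.reflectBetweenSites j a y)) =
          (0 : TorusSite 2 (2 * k) → ℝ) := rfl
      rw [h0, ← hA₀, ← hM₀] at h
      rw [hXXZ Δ hΔ', h, submatrix_kroneckerForm, submatrix_kroneckerForm, smul_sub, smul_add, map_smul,
        map_smul, Finset.smul_sum]
      congr 1
      refine sum_congr rfl fun i _ => ?_
      rw [map_smul, map_smul, smul_mul_smul_comm, hc2]
  · -- `Δ = 0`: Kennedy–Lieb–Shastry's real form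
    have h := xyRealFieldHamiltonian_eq_submatrix (2 * k) j a hM 1 0
    have h0 : (fun y => (0 : TorusSite 2 (2 * k) → ℝ) (Torus.reflectBetweenSites j a y)) =
        (0 : TorusSite 2 (2 * k) → ℝ) := rfl
    rw [h0] at h
    refine transverseGram_posSemidef_of_kroneckerForm (2 * k) j a hM 1 hH hHU hWW hWW' hW0
      (xyLeftHamiltonian (2 * k) j a hM 1 0) (xyCrossOp (2 * k) j a hM 1 0)
      (xyLeftHamiltonian_transpose (2 * k) j a 1 hM 0) (xyCrossOp_transpose_eq (2 * k) j a 1 hM 0) ?_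
      hψ hψ1 x hx
    rw [← h]
    exact hXY

/-- **Reflection positivity of the transverse kernel of the half-filled sector ground state**, in the
form the route's statements quantify over: for even `M ≥ 4`, `Δ ≤ 0` and every normalised `ψ` with
`H_M(Δ) ψ = E₀(S³_tot = 0) ψ` (the sector energy IS the ground energy, `xxzTorus_groundSpace_eq_span`),
the Gram matrix `[⟨ψ, S¹_{x_l} S¹_{θ x_i} ψ⟩]_{il}` of left-half sites is positive semidefinite.
[folklore] -/
theorem sectorGS_transverseGram_posSemidef_of_sectorGS (M : ℕ) [NeZero M] (hM : Even M) (h4 : 4 ≤ M)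
    {Δ : ℝ} (hΔ : Δ ≤ 0) {ψ : TensorIndex (TorusSite 2 M) 2 → ℂ} (hψ1 : star ψ ⬝ᵥ ψ = 1)
    (hHψ : (xxzHamiltonian 1 (torusGraph 2 M) (-1) Δ) *ᵥ ψ =
      ((lowestEnergyInSector 1 (xxzHamiltonian 1 (torusGraph 2 M) (-1) Δ) 0 : ℝ) : ℂ) • ψ)
    (j : Fin 2) (a : ZMod M) {κ : Type*} [Fintype κ] (x : κ → TorusSite 2 M)
    (hx : ∀ i, x i ∈ torusLeftHalf M j a) :
    (Matrix.of fun i l : κ => star ψ ⬝ᵥ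
      ((siteSpin 1 (x l) 0 * siteSpin 1 (Torus.reflectBetweenSites j a (x i)) 0) *ᵥ ψ)).PosSemidef := by
  obtain ⟨-, -, -, -, hEsec⟩ := xxzTorus_groundSpace_eq_span M hM h4 hΔ
  rw [hEsec] at hHψ
  exact sectorGS_transverseGram_posSemidef M hM h4 hΔ ((mem_groundSpace_iff _ ψ).2 hHψ) hψ1 j a x hx

/-- **One site**: `0 ≤ ⟨ψ, S¹_x S¹_{θx} ψ⟩` (a nonnegative real number) for every unit ground vector
of the easy-plane XXZ torus and every site `x` of the left half. [folklore] -/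
theorem sectorGS_transverse_reflect_nonneg (M : ℕ) [NeZero M] (hM : Even M) (h4 : 4 ≤ M)
    {Δ : ℝ} (hΔ : Δ ≤ 0) {ψ : TensorIndex (TorusSite 2 M) 2 → ℂ}
    (hψ : ψ ∈ (xxzHamiltonian 1 (torusGraph 2 M) (-1) Δ).groundSpace) (hψ1 : star ψ ⬝ᵥ ψ = 1)
    (j : Fin 2) (a : ZMod M) {x : TorusSite 2 M} (hx : x ∈ torusLeftHalf M j a) :
    0 ≤ star ψ ⬝ᵥ ((siteSpin 1 x 0 * siteSpin 1 (Torus.reflectBetweenSites j a x) 0) *ᵥ ψ) := by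
  have h := (sectorGS_transverseGram_posSemidef M hM h4 hΔ hψ hψ1 j a (fun _ : Fin 1 => x)
    (fun _ => hx)).diag_nonneg (i := 0)
  simpa only [of_apply] using h

/-- **Two sites (reflection Cauchy–Schwarz)**: `|⟨ψ, S¹_x S¹_{θy} ψ⟩|² ≤ ⟨ψ, S¹_x S¹_{θx} ψ⟩ ·
⟨ψ, S¹_y S¹_{θy} ψ⟩` for every unit ground vector of the easy-plane XXZ torus and sites `x`, `y`
of the left half. [folklore] -/
theorem sectorGS_transverse_reflection_cauchySchwarz (M : ℕ) [NeZero M] (hM : Even M) (h4 : 4 ≤ M)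
    {Δ : ℝ} (hΔ : Δ ≤ 0) {ψ : TensorIndex (TorusSite 2 M) 2 → ℂ}
    (hψ : ψ ∈ (xxzHamiltonian 1 (torusGraph 2 M) (-1) Δ).groundSpace) (hψ1 : star ψ ⬝ᵥ ψ = 1)
    (j : Fin 2) (a : ZMod M) {x y : TorusSite 2 M} (hx : x ∈ torusLeftHalf M j a)
    (hy : y ∈ torusLeftHalf M j a) :
    Complex.normSq (star ψ ⬝ᵥ ((siteSpin 1 x 0 * siteSpin 1 (Torus.reflectBetweenSites j a y) 0) *ᵥ ψ)) ≤
      (star ψ ⬝ᵥ ((siteSpin 1 x 0 * siteSpin 1 (Torus.reflectBetweenSites j a x) 0) *ᵥ ψ)).re *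
        (star ψ ⬝ᵥ ((siteSpin 1 y 0 * siteSpin 1 (Torus.reflectBetweenSites j a y) 0) *ᵥ ψ)).re := by
  have hxy : ∀ i : Fin 2, (![y, x] : Fin 2 → TorusSite 2 M) i ∈ torusLeftHalf M j a := by
    intro i; fin_cases i
    · exact hy
    · exact hx
  have h := Matrix.normSq_apply_le_of_posSemidef_fin_two
    (sectorGS_transverseGram_posSemidef M hM h4 hΔ hψ hψ1 j a ![y, x] hxy)
  simp only [of_apply, Matrix.cons_val_zero, Matrix.cons_val_one] at h
  rw [mul_comm]
  exact h


/-- **Reflection positivity in the crux's own vocabulary** (the `S⁺S⁻` kernel of `Block2InfDivXXZ`):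
for even `M ≥ 4`, `Δ ≤ 0`, every normalised half-filled sector ground state `ψ` of `H_M(Δ)`, every
pair of planes `(j, a)` and left-half sites `x₁, …, x_k`, the matrix
`[⟨ψ, S⁺_{x_l} S⁻_{θ x_i} ψ⟩]_{il}` is positive semidefinite — it is `2·[⟨ψ, S¹_{x_l} S¹_{θ x_i} ψ⟩]`
(`ω₀(S⁺_x S⁻_y) = 2 ω₀(Sˣ_x Sˣ_y)`, `Infrared.xyz₃_groundStateFunctional_raiseLower`, and
`ω₀ = ⟨ψ, · ψ⟩`, `sectorGS_expect_eq_groundStateFunctional`). In particular the route's real kernel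
`K_ψ(x, y) = Re ⟨ψ, S⁺_x S⁻_y ψ⟩` is reflection positive across every bond plane. [folklore] -/
theorem sectorGS_raiseLowerGram_posSemidef (M : ℕ) [NeZero M] (hM : Even M) (h4 : 4 ≤ M)
    {Δ : ℝ} (hΔ : Δ ≤ 0) {ψ : TensorIndex (TorusSite 2 M) 2 → ℂ} (hψ1 : star ψ ⬝ᵥ ψ = 1)
    (hHψ : (xxzHamiltonian 1 (torusGraph 2 M) (-1) Δ) *ᵥ ψ =
      ((lowestEnergyInSector 1 (xxzHamiltonian 1 (torusGraph 2 M) (-1) Δ) 0 : ℝ) : ℂ) • ψ)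
    (j : Fin 2) (a : ZMod M) {κ : Type*} [Fintype κ] (x : κ → TorusSite 2 M)
    (hx : ∀ i, x i ∈ torusLeftHalf M j a) :
    (Matrix.of fun i l : κ => star ψ ⬝ᵥ
      ((onSite (x l) (spinRaise 1) * onSite (Torus.reflectBetweenSites j a (x i)) (spinLower 1)) *ᵥ
        ψ)).PosSemidef := by
  have h2 : ∀ u v : TorusSite 2 M,
      star ψ ⬝ᵥ ((onSite u (spinRaise 1) * onSite v (spinLower 1)) *ᵥ ψ) =
        2 * (star ψ ⬝ᵥ ((siteSpin 1 u 0 * siteSpin 1 v 0) *ᵥ ψ)) := by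
    intro u v
    rw [← sectorGS_expect_eq_groundStateFunctional M hM h4 hΔ ψ hψ1 hHψ,
      ← sectorGS_expect_eq_groundStateFunctional M hM h4 hΔ ψ hψ1 hHψ, xxzTorus_eq_xyzBondHamiltonian₃,
      Infrared.xyz₃_groundStateFunctional_raiseLower]
  have hG : (Matrix.of fun i l : κ => star ψ ⬝ᵥ
      ((onSite (x l) (spinRaise 1) * onSite (Torus.reflectBetweenSites j a (x i)) (spinLower 1)) *ᵥ ψ)) =
      (Matrix.of fun i l : κ => star ψ ⬝ᵥ
        ((siteSpin 1 (x l) 0 * siteSpin 1 (Torus.reflectBetweenSites j a (x i)) 0) *ᵥ ψ)) +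
      Matrix.of fun i l : κ => star ψ ⬝ᵥ
        ((siteSpin 1 (x l) 0 * siteSpin 1 (Torus.reflectBetweenSites j a (x i)) 0) *ᵥ ψ) := by
    ext i l
    simp only [of_apply, Matrix.add_apply, h2, two_mul]
  rw [hG]
  exact (sectorGS_transverseGram_posSemidef_of_sectorGS M hM h4 hΔ hψ1 hHψ j a x hx).add
    (sectorGS_transverseGram_posSemidef_of_sectorGS M hM h4 hΔ hψ1 hHψ j a x hx)

/-- **Registered form** (sub-goal `sectorGS_transverseGram_posSemidef_all` of
stmt-HubbardSuperconductivity-15048): for every even `M ≥ 4`, `Δ ≤ 0`, every normalised half-filled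
sector ground state `ψ` of `H_M(Δ)` (sector energy form), every pair of planes `(j, a)` and every
finite family of left-half sites, the Gram matrix `[⟨ψ, S¹_{x_l} S¹_{θ x_i} ψ⟩]_{il}` is positive
semidefinite. [folklore] -/
theorem sectorGS_transverseGram_posSemidef_all : ∀ (M : ℕ) [NeZero M], Even M → 4 ≤ M → ∀ (Δ : ℝ), Δ ≤ 0 → ∀ (ψ : TensorIndex (TorusSite 2 M) 2 → ℂ), star ψ ⬝ᵥ ψ = 1 → Matrix.mulVec (xxzHamiltonian 1 (torusGraph 2 M) (-1) Δ) ψ = ((lowestEnergyInSector 1 (xxzHamiltonian 1 (torusGraph 2 M) (-1) Δ) 0 : ℝ) : ℂ) • ψ → ∀ (j : Fin 2) (a : ZMod M) (k : ℕ) (x : Fin k → TorusSite 2 M), (∀ i, x i ∈ torusLeftHalf M j a) → (Matrix.of fun i l : Fin k => star ψ ⬝ᵥ Matrix.mulVec (siteSpin 1 (x l) 0 * siteSpin 1 (Torus.reflectBetweenSites j a (x i)) 0) ψ).PosSemidef :=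
  fun M _ hM h4 _ hΔ _ hψ1 hHψ j a _ x hx =>
    sectorGS_transverseGram_posSemidef_of_sectorGS M hM h4 hΔ hψ1 hHψ j a x hx

end Summit.HubbardSuperconductivity.HubbardSuperconductivity.Theorems.LevyLogBootstrap

end
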